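import Summits.HodgeConjecture.CorCM.CyclicTimesPrimeCMTypes
import Mathlib.RingTheory.RootsOfUnity.Complex
import HarnessLib

/-!
# Abelian CM fields of `2`-power degree: a CM type is degenerate iff it is EQUIDISTRIBUTED over some odd
# character (Yanai's `a = b` over the cyclic CM subquotient of the character) — the converse of Yanai's criterion

COR-CM (cell `pub-hodgecm2`), binder seat b04 (gen 12), count-neutral, claim TWO-POWER-CRITERION; sequel of
`CorCM/CyclicTwoPowerCMTypes` (gen 11: CYCLIC `2`-groups, every type nondegenerate) and of CYCLIC-CLASSIF
(`CorCM/CyclicCompositeCMTypes`, `CorCM/CyclicCMTypesClassification`).  KERNEL ONLY: theorems; no definition, no named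
fact, no `sorry`.

Say a type `S ⊆ G` is EQUIDISTRIBUTED over a character `χ` of the finite group `G` if for every `g ∈ G` the values
`χ(g)` and `−χ(g)` are taken equally often on `S`: `#{s ∈ S : χ(s) = χ(g)} = #{s ∈ S : χ(s) = −χ(g)}` (for an odd
character, `χ(ρ) = −1`, and a CM type `S`: every fibre of `χ` meets `S` in exactly half of its points — over the CM
field `k = K^{ker χ}`, whose Galois group `G/ker χ` is CYCLIC, the type takes exactly `[K:k]/2` of the extensions of
every embedding of `k`: Yanai's condition `a = b` [Gordon 9.4.3, Theorem [B.140]], tree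
`Pohlmann1968.not_isNondegenerate_of_fibres_balanced`; for `χ` of order `2` this is WEIL TYPE `(n/2, n/2)` over the
imaginary quadratic field `K^{ker χ}`).

* `sum_eq_zero_of_equidistributed` — equidistributed over `χ` ⟹ `Σ_{s∈S} χ(s) = 0` (any finite group: the multiset
  of values is stable under `v ↦ −v`).
* `equidistributed_of_sum_eq_zero` — THE CONVERSE when the values of `χ` are `2^{n+1}`-th roots of unity: then
  `Σ_{s∈S} χ(s) = Σ_{r<2^n} (c_r − c_{2^n+r}) ω^r` for `ω = e^{2πi/2^{n+1}}` and the fibre counts `c_r`, and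
  `1, ω, …, ω^{2^n−1}` are linearly independent over `ℚ` (`X^{2^n} + 1` is the minimal polynomial of `ω`; gen 11's
  `CyclicTwoPower.aeval_ne_zero_of_pow_eq_neg_one`).  For characters whose order is not a `2`-power this fails
  (`1 + ζ₃ + ζ₃² = 0`): the imprimitive types of `ℚ(ζ₁₃)` and Serre's type on `ℚ(ζ₁₉)` are degenerate but
  equidistributed over no character.
* `typeRank_eq_iff_forall_not_equidistributed`, `typeRank_add_ncard_equidistributed` — with Kubota's Lemma 2
  (tree `IsCMTypeWith.typeRank_eq_iff_forall_oddCharacters`, `…typeRank_add_ncard_oddCharacters_vanishing`): for a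
  commutative group of order `2^{n+1}`, a CM type is nondegenerate iff it is equidistributed over NO odd character,
  and its Kubota defect is the NUMBER of odd characters over which it is equidistributed.
* `isNondegenerate_iff_forall_not_equidistributed` — number-field dress: `K` CM, normal over `ℚ`, ABELIAN Galois
  group of order `[K:ℚ] = 2^{n+1}` (`ℚ(ζ₁₆)`, `ℚ(ζ₃₂)`, `ℚ(ζ₄₀)`, `ℚ(ζ₄₈)`, `ℚ(ζ₆₀)`, `ℚ(ζ_{2^k})`, their CM
  subfields such as the cyclic octic `ℚ(ζ₃₂ − ζ₃₂⁻¹)`, composita with `ℚ(√−p)` …): `(K; Φ)` is nondegenerate iff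
  `{g | σ_g ∈ Φ}` is equidistributed over no odd character of `Gal(K/ℚ)`; `not_isNondegenerate_of_equidistributed` —
  the easy direction for every abelian CM field.  This is the structure behind the kernel censuses: at
  `m = 16, 20, 24` half of the `16` types and at `m = 32, 40, 48, 60` exactly `128` of the `256` types of `ℚ(ζₘ)` are
  degenerate (offline census of this seat), each of them of generalised Weil type over a cyclic CM subquotient.

## References

* [Kubota1965] T. Kubota, *On the field extension by complex multiplication*, Trans. AMS 118 (1965), §4 Lemma 2.
* [Gordon1999HodgeAVSurvey] B. B. Gordon, *A survey of the Hodge conjecture for abelian varieties*, Prop. 9.4.1,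
  §9.4.2 (Lenstra's types on `ℚ(ζ₃₂)`), §9.4.3 (Theorem [B.140] = Yanai 1994).
* [Dodson1984] B. Dodson, *The structure of Galois groups of CM-fields*, Trans. AMS 283 (1984), §3.1.1, §5.2.
* [Shimura1998] G. Shimura, *Abelian Varieties with Complex Multiplication and Modular Functions*, §8.1, §18.2.
-/

noncomputable section

open Polynomial NumberField

namespace Summit.HodgeConjecture.CorCM.AbelianTwoPower

open Literature.NumberTheory.ComplexMultiplication
open Literature.AlgebraicGeometry.Motives (CMType)
open Literature.AlgebraicGeometry.Pohlmann1968
open Summit.HodgeConjecture.CorCM.CyclicTwoPower (aeval_ne_zero_of_pow_eq_neg_one exists_conj_gal)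

/-! ### §1 Equidistributed ⟹ the character sum vanishes (any finite group) -/

section AnyGroup

variable {G : Type*} [Group G]

/-- **If `S` is equidistributed over `χ` then `Σ_{s∈S} χ(s) = 0`**: the set `V` of values of `χ` on `S` is stable
under `v ↦ −v` with equal multiplicities, so the sum `T = Σ_{v∈V} #χ⁻¹(v)·v` satisfies `T = −T`.  (Yanai's `a = b`
criterion read through one character.) [cite: Gordon1999HodgeAVSurvey, §9.4.3 (Theorem [B.140])] -/
theorem sum_eq_zero_of_equidistributed (χ : AddChar (Additive G) ℂ) (S : Finset G)
    (hE : ∀ g : G, (S.filter fun s => χ (Additive.ofMul s) = χ (Additive.ofMul g)).card =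
      (S.filter fun s => χ (Additive.ofMul s) = -χ (Additive.ofMul g)).card) :
    ∑ s ∈ S, χ (Additive.ofMul s) = 0 := by
  classical
  set f : G → ℂ := fun s => χ (Additive.ofMul s) with hf
  change ∑ s ∈ S, f s = 0
  have hE' : ∀ v ∈ S.image f, (S.filter fun s => f s = -v).card = (S.filter fun s => f s = v).card := by
    intro v hv
    obtain ⟨g, -, rfl⟩ := Finset.mem_image.1 hv
    exact (hE g).symm
  have hneg : ∀ v ∈ S.image f, -v ∈ S.image f := by
    intro v hv
    have hpos : 0 < (S.filter fun s => f s = -v).card := by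
      rw [hE' v hv, Finset.card_pos]
      obtain ⟨g, hg, rfl⟩ := Finset.mem_image.1 hv
      exact ⟨g, Finset.mem_filter.2 ⟨hg, rfl⟩⟩
    obtain ⟨s, hs⟩ := Finset.card_pos.1 hpos
    rw [Finset.mem_filter] at hs
    exact Finset.mem_image.2 ⟨s, hs.1, hs.2⟩
  have himage : (S.image f).image (fun v => -v) = S.image f :=
    Finset.eq_of_subset_of_card_le
      (fun w hw => by obtain ⟨v, hv, rfl⟩ := Finset.mem_image.1 hw; exact hneg v hv)
      (by rw [Finset.card_image_of_injective _ neg_injective])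
  have hdec : ∑ s ∈ S, f s = ∑ v ∈ S.image f, ((S.filter fun s => f s = v).card : ℂ) * v := by
    have h := Finset.sum_comp (s := S) (fun v : ℂ => v) f
    simp only [nsmul_eq_mul] at h
    exact h
  have hT : ∑ v ∈ S.image f, ((S.filter fun s => f s = v).card : ℂ) * v =
      -∑ v ∈ S.image f, ((S.filter fun s => f s = v).card : ℂ) * v := by
    conv_lhs => rw [← himage, Finset.sum_image fun a _ b _ h => neg_injective h]
    rw [← Finset.sum_neg_distrib]
    exact Finset.sum_congr rfl fun v hv => by rw [hE' v hv]; ring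
  rw [hdec]
  exact add_self_eq_zero.1 (eq_neg_iff_add_eq_zero.1 hT)

/-! ### §2 The converse for characters with values in the `2^{n+1}`-th roots of unity -/

/-- **If the values of `χ` are `2^{n+1}`-th roots of unity and `Σ_{s∈S} χ(s) = 0`, then `S` is equidistributed over
`χ`.**  With `ω = e^{2πi/2^{n+1}}` (`ω^{2^n} = −1`) and `c_r = #{s ∈ S : χ(s) = ω^r}`,
`Σ_{s∈S} χ(s) = Σ_{r<2^n} (c_r − c_{2^n+r}) ω^r`, and `1, ω, …, ω^{2^n−1}` are linearly independent over `ℚ`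
(`Φ_{2^{n+1}} = X^{2^n} + 1`), so `c_r = c_{2^n + r}`: the counts at `v` and `−v` agree. [cite: Kubota1965, §4 Lemma 2]
[cite: Gordon1999HodgeAVSurvey, §9.4.2] -/
theorem equidistributed_of_sum_eq_zero (χ : AddChar (Additive G) ℂ) {n : ℕ}
    (hχ : ∀ g : G, χ (Additive.ofMul g) ^ 2 ^ (n + 1) = 1) (S : Finset G)
    (h0 : ∑ s ∈ S, χ (Additive.ofMul s) = 0) (g : G) :
    (S.filter fun s => χ (Additive.ofMul s) = χ (Additive.ofMul g)).card =
      (S.filter fun s => χ (Additive.ofMul s) = -χ (Additive.ofMul g)).card := by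
  classical
  set m : ℕ := 2 ^ n with hm
  set f : G → ℂ := fun s => χ (Additive.ofMul s) with hf
  change (S.filter fun s => f s = f g).card = (S.filter fun s => f s = -f g).card
  have hN0 : 2 ^ (n + 1) ≠ 0 := by positivity
  have hω : IsPrimitiveRoot (Complex.exp (2 * Real.pi * Complex.I / (2 ^ (n + 1) : ℕ))) (2 ^ (n + 1)) :=
    Complex.isPrimitiveRoot_exp _ hN0
  set ω : ℂ := Complex.exp (2 * Real.pi * Complex.I / (2 ^ (n + 1) : ℕ)) with hωdef
  have h2m : 2 ^ (n + 1) = m + m := by rw [hm, pow_succ]; ring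
  have hωm : ω ^ m = -1 := (hω.pow (by positivity) (by rw [h2m]; ring)).eq_neg_one_of_two_right
  have hnegpow : ∀ r : ℕ, -ω ^ r = ω ^ (m + r) := fun r => by rw [pow_add, hωm]; ring
  -- every value is `ω^r`, `r < 2^{n+1}`
  have hval : ∀ s : G, ∃ r < 2 ^ (n + 1), ω ^ r = f s := fun s => hω.eq_pow_of_pow_eq_one (hχ s)
  choose e he_lt he_eq using hval
  set c : ℕ → ℕ := fun r => (S.filter fun s => f s = ω ^ r).card with hc
  -- the sum, fibrewise
  have hsum : ∑ s ∈ S, f s = ∑ r ∈ Finset.range (2 ^ (n + 1)), (c r : ℂ) * ω ^ r := by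
    rw [← Finset.sum_fiberwise_of_maps_to (t := Finset.range (2 ^ (n + 1))) (g := e)
      (fun s _ => Finset.mem_range.2 (he_lt s))]
    refine Finset.sum_congr rfl fun r hr => ?_
    rw [Finset.mem_range] at hr
    have hfib : (S.filter fun s => e s = r) = S.filter fun s => f s = ω ^ r := by
      ext s
      simp only [Finset.mem_filter, and_congr_right_iff]
      exact fun _ => ⟨fun h => by rw [← he_eq s, h], fun h => hω.pow_inj (he_lt s) hr (by rw [he_eq s, h])⟩
    rw [hfib, Finset.sum_congr rfl fun s hs => (Finset.mem_filter.1 hs).2, Finset.sum_const, nsmul_eq_mul]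
  -- `Σ_{r<2m} c_r ω^r = Σ_{r<m} (c_r − c_{m+r}) ω^r`
  have hsplit : ∑ r ∈ Finset.range (2 ^ (n + 1)), (c r : ℂ) * ω ^ r =
      ∑ r ∈ Finset.range m, ((c r : ℂ) - c (m + r)) * ω ^ r := by
    rw [h2m, Finset.sum_range_add, ← Finset.sum_add_distrib]
    exact Finset.sum_congr rfl fun r _ => by rw [← hnegpow]; ring
  -- the polynomial `P = Σ (c_r − c_{m+r}) X^r` vanishes at `ω`, hence is `0`
  let P : ℚ[X] := ∑ r ∈ Finset.range m, monomial r ((c r : ℚ) - c (m + r))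
  have hPeval : aeval ω P = 0 := by
    have h : aeval ω P = ∑ r ∈ Finset.range m, ((c r : ℂ) - c (m + r)) * ω ^ r := by
      simp only [P, map_sum, aeval_monomial, eq_ratCast]
      push_cast
      rfl
    rw [h, ← hsplit, ← hsum]
    exact h0
  have hPdeg : P.natDegree < m := by
    have hm0 : 0 < m := by positivity
    have h1 : P.natDegree ≤ m - 1 :=
      natDegree_sum_le_of_forall_le _ _ fun i hi =>
        (natDegree_monomial_le _).trans (by have := Finset.mem_range.1 hi; omega)
    omega
  have hP0 : P = 0 := by
    by_contra hP0
    exact aeval_ne_zero_of_pow_eq_neg_one hm hωm hP0 hPdeg hPeval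
  have hcoeff : ∀ r < m, c r = c (m + r) := by
    intro r hr
    have h : P.coeff r = (c r : ℚ) - c (m + r) := by
      simp only [P, finsetSum_coeff, coeff_monomial]
      rw [Finset.sum_eq_single r (fun i _ hi => if_neg hi) (fun h => absurd (Finset.mem_range.2 hr) h), if_pos rfl]
    rw [hP0, coeff_zero] at h
    exact_mod_cast (sub_eq_zero.1 h.symm)
  -- conclusion at `g`: `f g = ω^{e g}`
  have hr := he_lt g
  rw [← he_eq g, hnegpow]
  by_cases hrm : e g < m
  · exact hcoeff _ hrm
  · obtain ⟨r', hr'⟩ : ∃ r', e g = m + r' := ⟨e g - m, by omega⟩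
    have hr'm : r' < m := by omega
    rw [hr', show m + (m + r') = 2 ^ (n + 1) + r' by omega, pow_add ω (2 ^ (n + 1)) r', hω.pow_eq_one, one_mul]
    exact (hcoeff r' hr'm).symm

/-- For a group of order `2^{n+1}` every character takes values in the `2^{n+1}`-th roots of unity. [folklore] -/
theorem addChar_pow_card_eq_one [Fintype G] (χ : AddChar (Additive G) ℂ) (g : G) :
    χ (Additive.ofMul g) ^ Fintype.card G = 1 := by
  rw [← AddChar.map_nsmul_eq_pow, ← ofMul_pow, pow_card_eq_one, ofMul_one, AddChar.map_zero_eq_one]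

end AnyGroup

/-! ### §3 With Kubota's Lemma 2: nondegenerate ⟺ equidistributed over no odd character -/

section CommGroup

variable {G : Type*} [CommGroup G] [Fintype G] [DecidableEq G] {ρ : G} {Φ : Finset G}

/-- **A CM type of a commutative group of order `2^{n+1}` is nondegenerate iff it is equidistributed over NO odd
character.** [cite: Kubota1965, §4 Lemma 2] [cite: Gordon1999HodgeAVSurvey, §9.4.3] -/
theorem typeRank_eq_iff_forall_not_equidistributed (hΦ : IsCMTypeWith ρ (Φ : Set G)) {n : ℕ}
    (hcard : Fintype.card G = 2 ^ (n + 1)) :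
    typeRank G (Φ : Set G) = Fintype.card G / 2 + 1 ↔
      ∀ χ : AddChar (Additive G) ℂ, χ (Additive.ofMul ρ) = -1 →
        ¬∀ g : G, (Φ.filter fun s => χ (Additive.ofMul s) = χ (Additive.ofMul g)).card =
          (Φ.filter fun s => χ (Additive.ofMul s) = -χ (Additive.ofMul g)).card := by
  rw [hΦ.typeRank_eq_iff_forall_oddCharacters]
  refine forall_congr' fun χ => imp_congr_right fun _ => ⟨fun hne hE => hne (sum_eq_zero_of_equidistributed χ Φ hE),
    fun hnot h0 => hnot fun g => equidistributed_of_sum_eq_zero χ (n := n)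
      (fun g => by rw [← hcard]; exact addChar_pow_card_eq_one χ g) Φ h0 g⟩

/-- **The Kubota defect of a CM type of a commutative group of order `2^{n+1}` is the number of odd characters over
which it is equidistributed**: `rank(Φ) + #{χ odd : Φ equidistributed over χ} = 2^n + 1`.
[cite: Kubota1965, §4 Lemma 2] -/
theorem typeRank_add_ncard_equidistributed (hΦ : IsCMTypeWith ρ (Φ : Set G)) {n : ℕ}
    (hcard : Fintype.card G = 2 ^ (n + 1)) :
    typeRank G (Φ : Set G) +
        {χ : AddChar (Additive G) ℂ | χ (Additive.ofMul ρ) = -1 ∧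
          ∀ g : G, (Φ.filter fun s => χ (Additive.ofMul s) = χ (Additive.ofMul g)).card =
            (Φ.filter fun s => χ (Additive.ofMul s) = -χ (Additive.ofMul g)).card}.ncard = 2 ^ n + 1 := by
  have hρ1 : ρ ≠ 1 := by
    intro h; have := hΦ.rho_smul_ne (1 : G); rw [h, smul_eq_mul, one_mul] at this; exact this rfl
  have hρ2 : ρ * ρ = 1 := by have := hΦ.invol (1 : G); simpa [smul_eq_mul] using this
  have hset : {χ : AddChar (Additive G) ℂ | χ (Additive.ofMul ρ) = -1 ∧
      ∀ g : G, (Φ.filter fun s => χ (Additive.ofMul s) = χ (Additive.ofMul g)).card =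
        (Φ.filter fun s => χ (Additive.ofMul s) = -χ (Additive.ofMul g)).card} =
      {χ : AddChar (Additive G) ℂ | χ (Additive.ofMul ρ) = -1 ∧ ∑ s ∈ Φ, χ (Additive.ofMul s) = 0} := by
    ext χ
    simp only [Set.mem_setOf_eq, and_congr_right_iff]
    exact fun _ => ⟨sum_eq_zero_of_equidistributed χ Φ, fun h0 g => equidistributed_of_sum_eq_zero χ (n := n)
      (fun g => by rw [← hcard]; exact addChar_pow_card_eq_one χ g) Φ h0 g⟩
  have h := hΦ.typeRank_add_ncard_oddCharacters_vanishing
  have hodd := two_mul_ncard_oddCharacters_eq_card (G := G) hρ1 hρ2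
  rw [hcard, pow_succ] at hodd
  rw [hset, h]
  omega

end CommGroup

/-! ### §4 Abelian CM fields of degree `2^{n+1}` -/

section Field

variable {K : Type} [Field K] [NumberField K] [IsCMField K] [Normal ℚ K]

omit [IsCMField K] in
open scoped Classical in
/-- **The easy direction, for every ABELIAN CM field** (Yanai's `a = b`): if `{g | σ_g ∈ Φ}` is equidistributed over
some odd character of `Gal(K/ℚ)`, then `(K; Φ)` is degenerate. [cite: Gordon1999HodgeAVSurvey, §9.4.3 (Theorem [B.140])]
[cite: Kubota1965, §4 Lemma 2] -/
theorem not_isNondegenerate_of_equidistributed (hcomm : ∀ g h : K ≃ₐ[ℚ] K, g * h = h * g) (Φ : CMType K)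
    (φ₀ : K →+* ℂ) (ρ : K ≃ₐ[ℚ] K) (hρ : ∀ x, φ₀ (ρ x) = starRingEnd ℂ (φ₀ x))
    (χ : AddChar (Additive (K ≃ₐ[ℚ] K)) ℂ) (hχ : χ (Additive.ofMul ρ) = -1)
    (hE : ∀ g : K ≃ₐ[ℚ] K,
      ((Finset.univ.filter fun g' : K ≃ₐ[ℚ] K => embOf φ₀ g' ∈ Φ.1).filter
          fun g' => χ (Additive.ofMul g') = χ (Additive.ofMul g)).card =
        ((Finset.univ.filter fun g' : K ≃ₐ[ℚ] K => embOf φ₀ g' ∈ Φ.1).filter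
          fun g' => χ (Additive.ofMul g') = -χ (Additive.ofMul g)).card) :
    ¬IsNondegenerate Φ := by
  classical
  rw [isNondegenerate_iff_forall_oddCharacters hcomm Φ φ₀ ρ hρ, not_forall]
  exact ⟨χ, fun h => h hχ (sum_eq_zero_of_equidistributed χ _ hE)⟩

omit [IsCMField K] in
open scoped Classical in
/-- **THE CRITERION.**  For `K` CM, normal over `ℚ`, with ABELIAN Galois group of order `[K:ℚ] = 2^{n+1}`: `(K; Φ)` is
nondegenerate iff `{g | σ_g ∈ Φ}` is equidistributed over NO odd character `χ` of `Gal(K/ℚ)` — i.e. iff over no CM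
subquotient field `k = K^{ker χ}` with cyclic Galois group does `Φ` take exactly half of the extensions of every
embedding (generalised Weil type). [cite: Kubota1965, §4 Lemma 2] [cite: Gordon1999HodgeAVSurvey, §9.4.2, §9.4.3] -/
theorem isNondegenerate_iff_forall_not_equidistributed (hcomm : ∀ g h : K ≃ₐ[ℚ] K, g * h = h * g) {n : ℕ}
    (hK : Module.finrank ℚ K = 2 ^ (n + 1)) (Φ : CMType K) (φ₀ : K →+* ℂ) (ρ : K ≃ₐ[ℚ] K)
    (hρ : ∀ x, φ₀ (ρ x) = starRingEnd ℂ (φ₀ x)) :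
    IsNondegenerate Φ ↔ ∀ χ : AddChar (Additive (K ≃ₐ[ℚ] K)) ℂ, χ (Additive.ofMul ρ) = -1 →
      ¬∀ g : K ≃ₐ[ℚ] K,
        ((Finset.univ.filter fun g' : K ≃ₐ[ℚ] K => embOf φ₀ g' ∈ Φ.1).filter
            fun g' => χ (Additive.ofMul g') = χ (Additive.ofMul g)).card =
          ((Finset.univ.filter fun g' : K ≃ₐ[ℚ] K => embOf φ₀ g' ∈ Φ.1).filter
            fun g' => χ (Additive.ofMul g') = -χ (Additive.ofMul g)).card := by
  classical
  have hcard : Fintype.card (K ≃ₐ[ℚ] K) = 2 ^ (n + 1) := by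
    rw [Fintype.card_congr (Equiv.ofBijective (embOf φ₀) (embOf_bijective φ₀)), NumberField.Embeddings.card, hK]
  rw [isNondegenerate_iff_forall_oddCharacters hcomm Φ φ₀ ρ hρ]
  refine forall_congr' fun χ => imp_congr_right fun _ => ⟨fun hne hE => hne (sum_eq_zero_of_equidistributed χ _ hE),
    fun hnot h0 => hnot fun g => equidistributed_of_sum_eq_zero χ (n := n)
      (fun g => by rw [← hcard]; exact addChar_pow_card_eq_one χ g) _ h0 g⟩

open scoped Classical in
/-- **Instance-free form**: with Mathlib's complex conjugation the criterion needs no chosen `ρ` (for a CM field all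
embeddings induce the same conjugation, Shimura §18.2 Lemma). [cite: Shimura1998, §18.2 Lemma (i)]
[cite: Kubota1965, §4 Lemma 2] -/
theorem isNondegenerate_iff_forall_not_equidistributed' (hcomm : ∀ g h : K ≃ₐ[ℚ] K, g * h = h * g) {n : ℕ}
    (hK : Module.finrank ℚ K = 2 ^ (n + 1)) (Φ : CMType K) (φ₀ : K →+* ℂ) :
    IsNondegenerate Φ ↔ ∃ ρ : K ≃ₐ[ℚ] K, (∀ x, φ₀ (ρ x) = starRingEnd ℂ (φ₀ x)) ∧
      ∀ χ : AddChar (Additive (K ≃ₐ[ℚ] K)) ℂ, χ (Additive.ofMul ρ) = -1 →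
        ¬∀ g : K ≃ₐ[ℚ] K,
          ((Finset.univ.filter fun g' : K ≃ₐ[ℚ] K => embOf φ₀ g' ∈ Φ.1).filter
              fun g' => χ (Additive.ofMul g') = χ (Additive.ofMul g)).card =
            ((Finset.univ.filter fun g' : K ≃ₐ[ℚ] K => embOf φ₀ g' ∈ Φ.1).filter
              fun g' => χ (Additive.ofMul g') = -χ (Additive.ofMul g)).card := by
  obtain ⟨ρ, hρ⟩ := exists_conj_gal (K := K)
  rw [isNondegenerate_iff_forall_not_equidistributed hcomm hK Φ φ₀ ρ (hρ φ₀)]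
  constructor
  · exact fun h => ⟨ρ, hρ φ₀, h⟩
  · rintro ⟨ρ', hρ', h⟩
    have : ρ' = ρ := by
      apply AlgEquiv.ext; intro x; apply φ₀.injective; rw [hρ', hρ φ₀]
    subst this
    exact h

end Field

end Summit.HodgeConjecture.CorCM.AbelianTwoPower

end
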